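import Summits.CriticalPhenomena.PercolationContinuityZ3.Theorems.Transplant.SkelFrmQuasiBParamsClearF
import Summits.CriticalPhenomena.PercolationContinuityZ3.Theorems.Transplant.SkelFrmBParamsClearF
import Summits.CriticalPhenomena.PercolationContinuityZ3.Theorems.Transplant.SkelFrmQuasiBParamsFramesF2
import Summits.CriticalPhenomena.PercolationContinuityZ3.Theorems.Transplant.SkelFrmBParamsFramesF2
import Summits.CriticalPhenomena.PercolationContinuityZ3.Theorems.Transplant.SkelPhiFaceClearFloorsY
import Summits.CriticalPhenomena.PercolationContinuityZ3.Theorems.Transplant.PlanarSkeletonFrmQuasiDefs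
import Summits.CriticalPhenomena.PercolationContinuityZ3.Theorems.Transplant.PlanarSkeletonFrmDefs
import Summits.CriticalPhenomena.PercolationContinuityZ3.Theorems.Transplant.SkelPhiStepIDataNS
import Summits.CriticalPhenomena.PercolationContinuityZ3.Theorems.Transplant.SkelFrmQuasi1ParamsLBL
import Summits.CriticalPhenomena.PercolationContinuityZ3.Theorems.Transplant.SkelFrmQuasiBChoiceNums
import Summits.CriticalPhenomena.PercolationContinuityZ3.Theorems.Transplant.SkelFrmQuasiBParamsBridgeF
import Summits.CriticalPhenomena.PercolationContinuityZ3.Theorems.Transplant.SkelFrmQuasiBParamsFramesF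
import Summits.CriticalPhenomena.PercolationContinuityZ3.Theorems.Transplant.SkelFrmQuasiBParamsLF
import HarnessLib
import Summits.CriticalPhenomena.PercolationContinuityZ3.Theorems.Transplant.SkelFrmBParamsFaceFloorsClrYF
/-!
# GEN-Q PORT (WAVE-Q table v0.8 section 2, row G133, U-level L16; captain R-6/R-7 2026-08-27: carrier token swap `PlanarSkeletonFrmFrom ↦ PlanarSkeletonFrmQuasi`)
# of the tree module «Transplant/SkelFrmFromBParamsFaceFloorsClrYF» (sha256 7b40ee9b9316573f…) onto the quasi-step carrier `PlanarSkeletonFrmQuasi` (p507026): «SkelFrmQuasiBParamsFaceFloorsClrYF»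

ORIGINAL TITLE: (F) VALUE LAYER, N2 twin (hp-8 g42, 2026-08-23; F-DISCHARGE-MAP-N2 G18 y′ clearances): `port_frm.py` text of N1 `SkelNegBParamsFaceFloorsClrYF` (p1-g13) over

builds on p205010 (kernel theorem, internal audit signed; external expert review pending) — nothing in this file uses p205010; NOTHING is claimed about any open node
((N3-b), the end state).  Lane `prim-bschramm`, seat `prim-bschramm-gen-2` (gen 0; GEN-Q port pen #2 under RULING D-Q / D-Q-2; tool of record port_genq.py of the captain gen-1 g4).  Helper file (`--supports stmt-CriticalPhenomena-4575 --as helper`).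
PORT RULES (U-wave r1–r4 re-used, GEN-Q hunk classes of p3-g29 #6136): declaration order, names and proof texts are those of «SkelFrmFromBParamsFaceFloorsClrYF», byte-identical except
(i) the carrier token `PlanarSkeletonFrmFrom ↦ PlanarSkeletonFrmQuasi` in binders, `namespace`/`end` lines and qualified names (module names `SkelFrmFrom… ↦ SkelFrmQuasi…`
in imports of already-ported rows); (ii) `Φ.step ↦ Φ.qstep` with the called Steps lemma replaced by its `…Q`/`_q` twin and the cost `Φ.M` threaded (none in this file unless
listed below); (iii) `Φ.cyl_connected ↦ Φ.cyl_reach` readers (none unless listed); (iv) graph-ball radii / window floors ×`Φ.M` (none unless listed).  Carrier-free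
residents stay imported/exported from the original «SkelFrmBParamsFaceFloorsClrYF» exactly as in the FrmFrom port.  Docstrings and citations are the original's.

-/

noncomputable section

open scoped Classical

namespace Summit.CriticalPhenomena.PercolationContinuityZ3.Theorems.Transplant

namespace PlanarSkeletonFrmQuasi

namespace NegB

open Literature.Probability.Percolation Literature.Probability.LatticeModels SimpleGraph
open Literature.Probability.Percolation.KozmaNitzan.Cells (oth sgOf sgOf_sign)
open SkelConc (Consts)
open Skelφ (yBoxLoT yBoxHiT)
open Skelφ.StepI (DataN)
open Neg

namespace KS

section ClrYF

/-- **`hclrLo`, case same**: at `yL := yLFs σ σh` (`σ := sgOf du`), on the hop side `σ·σh = 1` (so `0 ≤ v_L`) every region `k ≤ Nr` of the along y′-run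
has its transverse floor above `M_u`, given `Nr + 1 ≤ c`. [cite: KozmaNitzan2024, §4 Lemma 11 (p. 22)] -/
theorem hclrLo_YFs (κ : Consts) {V : Type} [DecidableEq V] [Countable V] {G : SimpleGraph V} [G.LocallyFinite] (Φ : PlanarSkeletonFrmQuasi G) (t : V) (p : unitInterval) (D : Skelφ.StepI.DataNS V) (c : ℕ) (mk : ℕ) (g : ℕ) (f : ℕ) (hN : EqNumL κ Φ t p D g f) (du : MDir) {σh : ℤ} (hhop : sgOf du * σh = 1 → 0 ≤ vL κ Φ t p D g f) {Nr : ℕ} (hc : Nr + 1 ≤ c) :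
    sgOf du * σh = 1 → ∀ k ≤ Nr, ((Mu D : ℕ) : ℤ) < yBoxLoT (nL κ Φ t p D g f) (vL κ Φ t p D g f) (KS0.R'0N κ Φ (KS.NQ Φ) t p D mk) k +
      sgOf du * (yLFs κ Φ t p D c mk g f (sgOf du) σh) 0 := by
  intro h
  have ha := yLFs_zero κ Φ t p D c mk g f (sgOf_sign du) σh
  rw [h, one_mul] at ha
  exact Skelφ.hclrP_of_clearF hN.v_le (hhop h) (KS0.R'0N κ Φ (KS.NQ Φ) t p D mk) Nr (clo := (nL κ Φ t p D g f : ℤ) + nBF κ Φ t p D c mk - KS0.R'0N κ Φ (KS.NQ Φ) t p D mk)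
    (by linarith [ha]) (clearF_s κ Φ t p D c mk (nL κ Φ t p D g f) hc le_rfl)

/-- **`hclrHi`, case same**: on the opposite hop side `σ·σh = −1` (so `v_L ≤ 0`) every region's transverse ceiling stays below `−M_u`.
[cite: KozmaNitzan2024, §4 Lemma 11 (p. 22)] -/
theorem hclrHi_YFs (κ : Consts) {V : Type} [DecidableEq V] [Countable V] {G : SimpleGraph V} [G.LocallyFinite] (Φ : PlanarSkeletonFrmQuasi G) (t : V) (p : unitInterval) (D : Skelφ.StepI.DataNS V) (c : ℕ) (mk : ℕ) (g : ℕ) (f : ℕ) (hN : EqNumL κ Φ t p D g f) (du : MDir) {σh : ℤ} (hhop : sgOf du * σh = -1 → vL κ Φ t p D g f ≤ 0) {Nr : ℕ} (hc : Nr + 1 ≤ c) :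
    sgOf du * σh = -1 → ∀ k ≤ Nr, yBoxHiT (nL κ Φ t p D g f) (vL κ Φ t p D g f) (KS0.R'0N κ Φ (KS.NQ Φ) t p D mk) k +
      sgOf du * (yLFs κ Φ t p D c mk g f (sgOf du) σh) 0 < -((Mu D : ℕ) : ℤ) := by
  intro h
  have ha := yLFs_zero κ Φ t p D c mk g f (sgOf_sign du) σh
  rw [h] at ha
  exact Skelφ.hclrM_of_clearF hN.v_le (hhop h) (KS0.R'0N κ Φ (KS.NQ Φ) t p D mk) Nr (clo := (nL κ Φ t p D g f : ℤ) + nBF κ Φ t p D c mk - KS0.R'0N κ Φ (KS.NQ Φ) t p D mk)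
    (by linarith [ha]) (clearF_s κ Φ t p D c mk (nL κ Φ t p D g f) hc le_rfl)

-- GEN-Q (R-2, captain 2026-08-27): `PlanarSkeletonFrmFrom.NegB.KS.hclrLo_YFd` is not in the used cone of the node top — not ported.

-- GEN-Q (R-2, captain 2026-08-27): `PlanarSkeletonFrmFrom.NegB.KS.hclrHi_YFd` is not in the used cone of the node top — not ported.

-- GEN-Q (R-2, captain 2026-08-27): `PlanarSkeletonFrmFrom.NegB.KS.hclrLo_YFt` is not in the used cone of the node top — not ported.

-- GEN-Q (R-2, captain 2026-08-27): `PlanarSkeletonFrmFrom.NegB.KS.hclrHi_YFt` is not in the used cone of the node top — not ported.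

end ClrYF

end KS

end NegB

end PlanarSkeletonFrmQuasi

end Summit.CriticalPhenomena.PercolationContinuityZ3.Theorems.Transplant

end
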